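import Literature.Geometry.Kaehler.ComplexTorusNeronSeveriLieAlgebraIsogeny
import Literature.Geometry.Kaehler.ComplexTorusLefschetzSL2Action
import Literature.Geometry.Kaehler.GradedFormsSpCommutant
import Literature.Geometry.Kaehler.ComplexTorusHodgeGroup
import Literature.Algebra.Lie.LefschetzModuleSL2RepresentationFunctoriality
import Literature.Algebra.Lie.LefschetzModuleSL2RepresentationIntertwiners
import Literature.Algebra.Lie.LefschetzModuleTransport
import HarnessLib

/-!
# Beauville's `SL₂`-action and the Weyl operator of a polarised complex torus are NATURAL: transport along isomorphisms
# `T : H₁(X) ≃ H₁(X')` and isogenies `f : X → X'` with `f^*η' = η`, and `Sp(V, η)`-equivariance (hence `Hg(X)`-equivariance)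

Layer `Literature/Geometry/Kaehler`, namespace `Literature.Geometry.Kaehler.ComplexTorus`; lane `lit-hodgefound` (Track 2 foundations
library), prover seat `lit-hodgefound-p09` (generation 52, row g52-#6). THEOREMS ONLY (no definition, no named fact, no instance, no
notation; D-0026 net debt `0`). Sequel of row g51-#9 `ComplexTorusLefschetzSL2Action` (`ρ = (hasLefschetzProperty_lefschetzG hη).sl2Rep
isZGrading_countingG : SL(2, ℂ) →* End_ℂ(H•(X; ℂ))`, `ρ(1 a ; 0 1) = exp(a L_η)`, `ρ(1 0 ; a 1) = exp(a Λ_η)`, `ρ(0 −1 ; 1 0) = w`), of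
`ComplexTorusNeronSeveriLieAlgebraIsogeny` (the pull-back equivalence `pullEquivG T : H•(X'; ℂ) ≃ H•(X; ℂ)` of a real-linear isomorphism
`T : V ≃ V'`, `Ad(T^*) = adPull T`, `Ad(T^*) L_{η'} = L_{T^*η'}`, `Ad(T^*) h = h`, `Ad(T^*) Λ_{η'} = Λ_{T^*η'}`, and the isogeny isomorphism
`IsIsogeny.realRepEquiv`), of `GradedFormsSpCommutant` (`Sp(V, η)` commutes with `L_η`, `h`, `Λ_η` on `H•(X; ℂ)`, Goodman–Wallach (5.51)) and of
the abstract transport rows `Algebra/Lie/LefschetzModuleTransport` (`Φ w = w' Φ`), `…SL2RepresentationFunctoriality` (`Φ ρ(γ) = ρ'(γ) Φ`),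
`…SL2RepresentationIntertwiners` (`End_{SL₂}(M) = End_{𝔰𝔩₂}(M)`).

SETTING. `X = V/Λ`, `X' = V'/Λ'` complex tori (`V = E`, `V' = E'`), `H•(X; ℂ) = GForm E ℂ = Π_m Alt^m_ℝ(E; ℂ)`, `T^* = pullG T` the
pull-back of forms along a real-linear `T : V → V'`, `η'` a non-degenerate real `2`-form on `V'` and `T^*η' = η'.compContinuousLinearMap T`
(non-degenerate again when `T` is an isomorphism, `nondegenerate_pullTwo_iff`); `w_η = (hasLefschetzProperty_lefschetzG hη).weylOperator
isZGrading_countingG`, `ρ_η = (hasLefschetzProperty_lefschetzG hη).sl2Rep isZGrading_countingG`. All the operators are attached to the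
PAIR `(V, η)` alone; lattices enter only in §3–§4 (`Sp(V, E)(ℝ)`, `Hg(X)`, isogenies as integral matrices).

## What is proved

* §1 TRANSPORT ALONG `T : V ≃ V'`: `pullG_lefschetzG` (any real-linear `T`), `pullG_countingG` (equal dimensions),
  `compContinuousLinearMap_mem_primitiveForms_of_finrank_eq` / `…_iff` (primitive classes pull back to primitive classes),
  `pullG_lefschetzDualG`, **`pullG_weylOperator`: `T^*(w_{η'} x) = w_{T^*η'}(T^* x)`**, `adPull_weylOperator` (`Ad(T^*) w_{η'} = w_{T^*η'}`),
  **`pullG_sl2Rep`: `T^*(ρ_{η'}(γ) x) = ρ_{T^*η'}(γ)(T^* x)`** for every `γ ∈ SL₂(ℂ)`, `adPull_sl2Rep` — André: the operators attached to a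
  Lefschetz module are "compatibles … aux isomorphismes"; Looijenga–Lunts (1.1): the `𝔰𝔩₂`-partner "`f` is then unique".
* §2 `Sp(V, η)`-EQUIVARIANCE on one torus (`M : V → V` real-linear with `η(Mu, Mv) = η(u, v)`): **`commute_pullAlgHom_weylOperator`**,
  **`commute_pullAlgHom_sl2Rep`** (`M^*` commutes with `w_η` and with every `ρ_η(γ)`: it commutes with `L_η`, `h`, `Λ_η` — Goodman–Wallach
  (5.51), Lange Lemma 7.3.6 — and `End_{SL₂}(M) = End_{𝔰𝔩₂}(M)`), `pullG_weylOperator_of_preserves`, `pullG_sl2Rep_of_preserves`,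
  `weylOperator_of_compContinuousLinearMap`, `sl2Rep_of_compContinuousLinearMap` (component forms).
* §3 LATTICE FORM `X = E/Φ(ℤ^ι)`: for `N ∈ Sp(V, E)(ℝ)` (`spGroup Φ η`) and for the HODGE GROUP `Hg(X)(ℝ) ⊆ Sp(V, E)` of a Hodge class `η`
  (Lange Prop. 7.2.3, `hodgeGroup_le_spGroup`): `ρ_r(N)^*` commutes with `w_η` and `ρ_η(SL₂(ℂ))`
  (`pullG_weylOperator_analyticRepReal_of_mem_spGroup`, `pullG_sl2Rep_analyticRepReal_of_mem_spGroup`, `…_hodgeGroup`).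
* §4 ISOGENIES `f = ρ(A) : X → X'` (`IsIsogeny Φ Φ' A`, analytic representation `ρ_r(f) = realRep Φ Φ' A : V ≃ V'`) and a polarisation
  `η'` of `X'` pulled back to `f^*η'`: **`IsIsogeny.pullG_realRep_weylOperator`**, `IsIsogeny.adPull_realRepEquiv_weylOperator`,
  **`IsIsogeny.pullG_realRep_sl2Rep`**, `IsIsogeny.adPull_realRepEquiv_sl2Rep`, `IsIsogeny.nondegenerate_comp_realRep_iff` — Beauville's proof of the `SL₂`-action for an arbitrary
  polarisation: "We choose an isogeny `π` of `A` onto an abelian variety `A_0` with a principal polarization `θ_0` such that `θ = π^*θ_0` …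
  induces an isomorphism of algebras `Corr(A_0) ≅ Corr(A)`".

## Sources, VERBATIM

* A. Beauville, *The action of SL₂ on abelian varieties*, J. Ramanujan Math. Soc. 25 (2010) [Beauville2010SL2], held text
  `paper:arxiv-0805.1541` p0003 L52–L60, §3: "**Proposition** There is a (unique) group homomorphism `SL₂(ℤ) → Corr(A)^*` mapping `u` to
  `Δ_*e^θ` and `w` to `d⁻¹e^℘`. Proof: We choose an isogeny `π` of `A` onto an abelian variety `A_0` with a principal polarization `θ_0` such
  that `θ = π^*θ_0` ([Md], 23, Cor. 1 of Thm. 4). One checks readily that the `ℚ`-linear isomorphism `d⁻¹(π, π)^* : CH(A_0 × A_0) → CH(A × A)`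
  is compatible with the composition of correspondences, thus induces an isomorphism of algebras `Corr(A_0) ≅ Corr(A)`."
* H. Lange, *Abelian Varieties over the Complex Numbers* (2023) [Lange2023AbelianVarietiesComplex], §7.3.2 Lemma 7.3.6 (p. 338): "the element
  `E ∈ ⋀²V` is invariant under the action of the symplectic group … `L` is `Sp(V, E)`-equivariant"; §7.2.1 Prop. 7.2.3 (`Hg(X) ⊆ Sp(V, E)`);
  §1.1.2 Lemma 1.1.11 (the analytic representation of an isogeny is bijective on `V`).
* R. Goodman, N. R. Wallach, *Symmetry, Representations, and Invariants* (GTM 255, 2009) [GoodmanWallachGTM255], §5.5.1 (5.51) (p. 383):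
  "These operators on `⋀V` commute with the action of `G`".
* Y. André, *Pour une théorie inconditionnelle des motifs* (1996) [Andre1996Motifs], §1.2 (p. 11): the operators of a Lefschetz module are
  "compatibles … aux isomorphismes"; §1.3 (p. 12).
* E. Looijenga, V. A. Lunts, *A Lie algebra attached to a projective variety*, Invent. Math. 129 (1997) [LooijengaLunts1997], §1 (1.1) p. 4
  ("This `f` is then unique"), (1.9).
-/

noncomputable section

-- `Module ℂ` / `SMulZeroClass ℂ` synthesis on `E [⋀^Fin k]→L[ℝ] ℂ` (as in `ComplexTorusLefschetzDecomposition`)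
set_option maxSynthPendingDepth 3

namespace Literature.Geometry.Kaehler

namespace ComplexTorus

open Module Function Finset
open scoped MatrixGroups
open Literature.LinearAlgebra.Alternating Literature.Algebra.Lie

universe uE uE'

/-! ## §1 Transport along a real-linear isomorphism `T : V ≃ V'` -/

section Transport

variable {E : Type uE} [NormedAddCommGroup E] [NormedSpace ℂ E] [FiniteDimensional ℂ E] [Nontrivial E]
  {E' : Type uE'} [NormedAddCommGroup E'] [NormedSpace ℂ E'] [FiniteDimensional ℂ E'] [Nontrivial E']
  {η' : E' [⋀^Fin 2]→L[ℝ] ℝ}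

omit [FiniteDimensional ℂ E] [Nontrivial E] [FiniteDimensional ℂ E'] [Nontrivial E'] in
/-- **`T^*(L_{η'} x) = L_{T^*η'}(T^* x)`** for ANY real-linear `T : V → V'` (naturality of `η ∧ ·`). [cite: Lange2023AbelianVarietiesComplex, §7.3.2 Lemma 7.3.6 (p. 338)]
[cite: LooijengaLunts1997, §1 (1.9)] -/
theorem pullG_lefschetzG (T : E →L[ℝ] E') (η' : E' [⋀^Fin 2]→L[ℝ] ℝ) (x : GForm E' ℂ) :
    GForm.pullG T (lefschetzG η' x) = lefschetzG (η'.compContinuousLinearMap T) (GForm.pullG T x) := by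
  funext m
  rw [GForm.pullG_apply]
  match m with
  | 0 => rw [lefschetzG_apply_zero, lefschetzG_apply_zero]; ext v; simp
  | 1 => rw [lefschetzG_apply_one, lefschetzG_apply_one]; ext v; simp
  | m + 2 => rw [lefschetzG_apply_add_two, lefschetzG_apply_add_two, GForm.pullG_apply, lefschetzPow_compContinuousLinearMap]

omit [FiniteDimensional ℂ E] [Nontrivial E] [FiniteDimensional ℂ E'] [Nontrivial E'] in
/-- **`T^*(h x) = h(T^* x)`** when `dim V = dim V'` (pull-back preserves degrees). [cite: LooijengaLunts1997, §1 (1.1), (1.9)] -/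
theorem pullG_countingG (T : E →L[ℝ] E') (hT : finrank ℂ E = finrank ℂ E') (x : GForm E' ℂ) :
    GForm.pullG T (countingG E' x) = countingG E (GForm.pullG T x) := by
  funext m
  rw [GForm.pullG_apply, countingG_apply, countingG_apply, GForm.pullG_apply, hT]
  ext v
  simp only [ContinuousAlternatingMap.compContinuousLinearMap_apply, ContinuousAlternatingMap.smul_apply]

omit [FiniteDimensional ℂ E] [Nontrivial E] [FiniteDimensional ℂ E'] [Nontrivial E'] in
/-- **Primitive classes pull back to primitive classes**: `α ∈ Pᵏ(η') ⇒ T^*α ∈ Pᵏ(T^*η')` for any real-linear `T : V → V'` between spaces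
of the same dimension (`(T^*η')^{∧j} ∧ T^*α = T^*(η'^{∧j} ∧ α)`). [cite: Lange2023AbelianVarietiesComplex, §7.3.2 Lemma 7.3.6 (p. 338) and (1) (p. 338)] -/
theorem compContinuousLinearMap_mem_primitiveForms_of_finrank_eq (T : E →L[ℝ] E') (hT : finrank ℂ E = finrank ℂ E') {k : ℕ}
    {α : E' [⋀^Fin k]→L[ℝ] ℂ} (hα : α ∈ primitiveForms η' k) :
    α.compContinuousLinearMap T ∈ primitiveForms (η'.compContinuousLinearMap T) k := by
  rw [mem_primitiveForms_iff] at hα ⊢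
  rw [hT, ← wedgePow_ofRealForm_comp T η' (finrank ℂ E' - k + 1), ← ContinuousAlternatingMap.wedge_compContinuousLinearMap, hα]
  ext v
  simp

omit [FiniteDimensional ℂ E] [Nontrivial E] [FiniteDimensional ℂ E'] [Nontrivial E'] in
/-- `(T⁻¹)^*(T^* α) = α` on `k`-forms (plumbing). [folklore] -/
private theorem symm_comp_comp₆₆ {F : Type*} [NormedAddCommGroup F] [NormedSpace ℝ F] (T : E ≃L[ℝ] E') {k : ℕ}
    (α : E' [⋀^Fin k]→L[ℝ] F) :
    (α.compContinuousLinearMap (T : E →L[ℝ] E')).compContinuousLinearMap (T.symm : E' →L[ℝ] E) = α := by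
  ext v
  simp only [ContinuousAlternatingMap.compContinuousLinearMap_apply, comp_def, ContinuousLinearEquiv.coe_coe,
    ContinuousLinearEquiv.apply_symm_apply]

omit [FiniteDimensional ℂ E] [Nontrivial E] [FiniteDimensional ℂ E'] [Nontrivial E'] in
/-- A real-linear isomorphism of complex vector spaces preserves the complex dimension. [folklore] -/
private theorem finrank_eq_of_equiv₆₆ (T : E ≃L[ℝ] E') : finrank ℂ E = finrank ℂ E' := by
  have h := LinearEquiv.finrank_eq (T.toLinearEquiv : E ≃ₗ[ℝ] E')
  rw [finrank_real_of_complex, finrank_real_of_complex] at h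
  omega

omit [FiniteDimensional ℂ E] [Nontrivial E] [FiniteDimensional ℂ E'] [Nontrivial E'] in
/-- **`T^*α ∈ Pᵏ(T^*η') ⟺ α ∈ Pᵏ(η')`** for a real-linear ISOMORPHISM `T : V ≃ V'` ("isomorphism of `Sp(V, E)`-representations").
[cite: Lange2023AbelianVarietiesComplex, §7.3.2 (1) and Lemma 7.3.6 (p. 338)] -/
theorem compContinuousLinearMap_mem_primitiveForms_iff (T : E ≃L[ℝ] E') {k : ℕ} (α : E' [⋀^Fin k]→L[ℝ] ℂ) :
    α.compContinuousLinearMap (T : E →L[ℝ] E') ∈ primitiveForms (η'.compContinuousLinearMap (T : E →L[ℝ] E')) k ↔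
      α ∈ primitiveForms η' k := by
  refine ⟨fun h ↦ ?_, compContinuousLinearMap_mem_primitiveForms_of_finrank_eq _ (finrank_eq_of_equiv₆₆ T)⟩
  have h' := compContinuousLinearMap_mem_primitiveForms_of_finrank_eq (T.symm : E' →L[ℝ] E) (finrank_eq_of_equiv₆₆ T).symm h
  rwa [symm_comp_comp₆₆ T, symm_comp_comp₆₆ T] at h'

omit [FiniteDimensional ℂ E] [Nontrivial E] [FiniteDimensional ℂ E'] [Nontrivial E'] in
/-- `T^* h = h T^*` for the pull-back equivalence. [cite: LooijengaLunts1997, §1 (1.1), (1.9)] -/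
private theorem semiconj_countingG₆₆ (T : E ≃L[ℝ] E') (x : GForm E' ℂ) : pullEquivG T (countingG E' x) = countingG E (pullEquivG T x) := by
  have h := LinearMap.congr_fun (adPull_countingG T) (pullEquivG T x)
  rwa [adPull_apply_apply, ← pullEquivG_symm, LinearEquiv.symm_apply_apply] at h

omit [FiniteDimensional ℂ E] [Nontrivial E] [FiniteDimensional ℂ E'] [Nontrivial E'] in
/-- `T^* L_{η'} = L_{T^*η'} T^*` for the pull-back equivalence. [cite: LooijengaLunts1997, §1 (1.1), (1.9)] -/
private theorem semiconj_lefschetzG₆₆ (T : E ≃L[ℝ] E') (η' : E' [⋀^Fin 2]→L[ℝ] ℝ) (x : GForm E' ℂ) :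
    pullEquivG T (lefschetzG η' x) = lefschetzG (η'.compContinuousLinearMap (T : E →L[ℝ] E')) (pullEquivG T x) := by
  have h := LinearMap.congr_fun (adPull_lefschetzG T η') (pullEquivG T x)
  rwa [adPull_apply_apply, ← pullEquivG_symm, LinearEquiv.symm_apply_apply] at h

omit [FiniteDimensional ℂ E] [Nontrivial E] [FiniteDimensional ℂ E'] [Nontrivial E'] in
/-- `Ad(T^*) A = (T^*).conj A`. [folklore] -/
private theorem adPull_eq_conj₆₆ (T : E ≃L[ℝ] E') (A : Module.End ℂ (GForm E' ℂ)) : adPull T A = (pullEquivG T).conj A :=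
  LinearMap.ext fun _ ↦ rfl

omit [Nontrivial E'] in
/-- **`T^*(Λ_{η'} x) = Λ_{T^*η'}(T^* x)`** for a real-linear isomorphism `T : V ≃ V'` and a non-degenerate `η'` (the uniqueness of the
`𝔰𝔩₂`-partner; the tree's `adPull_lefschetzDualG` in applied form). [cite: LooijengaLunts1997, §1 (1.1) p. 4 ("This f is then unique"), (1.9)] -/
theorem pullG_lefschetzDualG (T : E ≃L[ℝ] E') (hη' : ∀ v : E', v ≠ 0 → ∃ w : E', η' ![v, w] ≠ 0) (x : GForm E' ℂ) :
    GForm.pullG (T : E →L[ℝ] E') (lefschetzDualG η' x) =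
      lefschetzDualG (η'.compContinuousLinearMap (T : E →L[ℝ] E')) (GForm.pullG (T : E →L[ℝ] E') x) := by
  have h := LinearMap.congr_fun (adPull_lefschetzDualG T hη') (pullEquivG T x)
  rwa [adPull_apply_apply, ← pullEquivG_symm, LinearEquiv.symm_apply_apply] at h

/-- **`T^*(w_{η'} x) = w_{T^*η'}(T^* x)`**: the Weyl operator is transported along every real-linear isomorphism `T : V ≃ V'` of the `H₁`'s
(`T^*` intertwines `h` and `L`, hence — André, Lemme via "`(0 1 ; −1 0)`" — the Weyl elements). [cite: Andre1996Motifs, §1.2 (p. 11) and §1.3 (p. 12)]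
[cite: LooijengaLunts1997, §1 (1.9)] -/
theorem pullG_weylOperator (T : E ≃L[ℝ] E') (hη' : ∀ v : E', v ≠ 0 → ∃ w : E', η' ![v, w] ≠ 0)
    (hη : ∀ v : E, v ≠ 0 → ∃ w : E, (η'.compContinuousLinearMap (T : E →L[ℝ] E')) ![v, w] ≠ 0) (x : GForm E' ℂ) :
    GForm.pullG (T : E →L[ℝ] E') ((hasLefschetzProperty_lefschetzG hη').weylOperator isZGrading_countingG x) =
      (hasLefschetzProperty_lefschetzG hη).weylOperator isZGrading_countingG (GForm.pullG (T : E →L[ℝ] E') x) :=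
  (hasLefschetzProperty_lefschetzG hη').map_weylOperator_of_semiconj isZGrading_countingG (hasLefschetzProperty_lefschetzG hη)
    isZGrading_countingG (Φ := (pullEquivG T).toLinearMap) (semiconj_countingG₆₆ T) (semiconj_lefschetzG₆₆ T η') x

/-- **`Ad(T^*) w_{η'} = w_{T^*η'}`.** [cite: Andre1996Motifs, §1.2 (p. 11) and §1.3 (p. 12)] [cite: LooijengaLunts1997, §1 (1.9)] -/
theorem adPull_weylOperator (T : E ≃L[ℝ] E') (hη' : ∀ v : E', v ≠ 0 → ∃ w : E', η' ![v, w] ≠ 0)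
    (hη : ∀ v : E, v ≠ 0 → ∃ w : E, (η'.compContinuousLinearMap (T : E →L[ℝ] E')) ![v, w] ≠ 0) :
    adPull T ((hasLefschetzProperty_lefschetzG hη').weylOperator isZGrading_countingG) =
      (hasLefschetzProperty_lefschetzG hη).weylOperator isZGrading_countingG := by
  rw [adPull_eq_conj₆₆]
  exact (hasLefschetzProperty_lefschetzG hη').conj_weylOperator_eq isZGrading_countingG (hasLefschetzProperty_lefschetzG hη)
    isZGrading_countingG (pullEquivG T) (semiconj_countingG₆₆ T) (semiconj_lefschetzG₆₆ T η')

/-- **`T^*(ρ_{η'}(γ) x) = ρ_{T^*η'}(γ)(T^* x)` for every `γ ∈ SL₂(ℂ)`**: Beauville's action is transported along every real-linear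
isomorphism of the `H₁`'s ("compatibles … aux isomorphismes"; on the generating unipotents `exp(a L)`, `exp(a Λ)`).
[cite: Andre1996Motifs, §1.2 (p. 11)] [cite: Beauville2010SL2, §3 Proposition ("(unique) group homomorphism")] [cite: LooijengaLunts1997, §1 (1.9)] -/
theorem pullG_sl2Rep (T : E ≃L[ℝ] E') (hη' : ∀ v : E', v ≠ 0 → ∃ w : E', η' ![v, w] ≠ 0)
    (hη : ∀ v : E, v ≠ 0 → ∃ w : E, (η'.compContinuousLinearMap (T : E →L[ℝ] E')) ![v, w] ≠ 0) (γ : SL(2, ℂ)) (x : GForm E' ℂ) :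
    GForm.pullG (T : E →L[ℝ] E') ((hasLefschetzProperty_lefschetzG hη').sl2Rep isZGrading_countingG γ x) =
      (hasLefschetzProperty_lefschetzG hη).sl2Rep isZGrading_countingG γ (GForm.pullG (T : E →L[ℝ] E') x) :=
  (hasLefschetzProperty_lefschetzG hη').map_sl2Rep_of_semiconj isZGrading_countingG (hasLefschetzProperty_lefschetzG hη)
    isZGrading_countingG (Φ := (pullEquivG T).toLinearMap) (semiconj_countingG₆₆ T) (semiconj_lefschetzG₆₆ T η') γ x

/-- **`Ad(T^*) ρ_{η'}(γ) = ρ_{T^*η'}(γ)`.** [cite: Andre1996Motifs, §1.2 (p. 11)] [cite: LooijengaLunts1997, §1 (1.9)] -/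
theorem adPull_sl2Rep (T : E ≃L[ℝ] E') (hη' : ∀ v : E', v ≠ 0 → ∃ w : E', η' ![v, w] ≠ 0)
    (hη : ∀ v : E, v ≠ 0 → ∃ w : E, (η'.compContinuousLinearMap (T : E →L[ℝ] E')) ![v, w] ≠ 0) (γ : SL(2, ℂ)) :
    adPull T ((hasLefschetzProperty_lefschetzG hη').sl2Rep isZGrading_countingG γ) =
      (hasLefschetzProperty_lefschetzG hη).sl2Rep isZGrading_countingG γ := by
  rw [adPull_eq_conj₆₆]
  exact (hasLefschetzProperty_lefschetzG hη').conj_sl2Rep_eq isZGrading_countingG (hasLefschetzProperty_lefschetzG hη)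
    isZGrading_countingG (pullEquivG T) (semiconj_countingG₆₆ T) (semiconj_lefschetzG₆₆ T η') γ

end Transport

/-! ## §2 `Sp(V, η)`-equivariance on one torus -/

section Sp

variable {E : Type uE} [NormedAddCommGroup E] [NormedSpace ℂ E] [FiniteDimensional ℂ E] [Nontrivial E] {η : E [⋀^Fin 2]→L[ℝ] ℝ}

/-- **`M^*` commutes with the Weyl operator for every `η`-preserving real-linear `M : V → V`** (`M^*` commutes with `L_η` and `Λ_η` —
"These operators on `⋀V` commute with the action of `G`", "`L` is `Sp(V, E)`-equivariant" — and `w = exp(Λ) exp(−L) exp(Λ)`).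
[cite: GoodmanWallachGTM255, §5.5.1 (5.51) (p. 383)] [cite: Lange2023AbelianVarietiesComplex, §7.3.2 Lemma 7.3.6 (p. 338)] [cite: Andre1996Motifs, §1.2 Prop. 1.2 (p. 11)] -/
theorem commute_pullAlgHom_weylOperator (hη : ∀ v : E, v ≠ 0 → ∃ w : E, η ![v, w] ≠ 0) {M : E →L[ℝ] E}
    (hM : ∀ u v : E, η ![M u, M v] = η ![u, v]) :
    Commute (GForm.pullAlgHom M).toLinearMap ((hasLefschetzProperty_lefschetzG hη).weylOperator isZGrading_countingG) := by
  have hL : Commute (GForm.pullAlgHom M).toLinearMap (lefschetzG η) := commute_pullAlgHom_lefschetzG hM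
  have hΛ : Commute (GForm.pullAlgHom M).toLinearMap (lefschetzDualG η) := commute_pullAlgHom_lefschetzDualG hη hM
  refine (hasLefschetzProperty_lefschetzG hη).commute_weylOperator isZGrading_countingG hL ?_
  rw [dual_lefschetzG_eq_lefschetzDualG hη]
  exact hΛ

/-- **`M^*(w x) = w(M^* x)`** for `η`-preserving `M`. [cite: GoodmanWallachGTM255, §5.5.1 (5.51) (p. 383)] [cite: Lange2023AbelianVarietiesComplex, §7.3.2 Lemma 7.3.6 (p. 338)] -/
theorem pullG_weylOperator_of_preserves (hη : ∀ v : E, v ≠ 0 → ∃ w : E, η ![v, w] ≠ 0) {M : E →L[ℝ] E}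
    (hM : ∀ u v : E, η ![M u, M v] = η ![u, v]) (x : GForm E ℂ) :
    GForm.pullG M ((hasLefschetzProperty_lefschetzG hη).weylOperator isZGrading_countingG x) =
      (hasLefschetzProperty_lefschetzG hη).weylOperator isZGrading_countingG (GForm.pullG M x) :=
  LinearMap.congr_fun (commute_pullAlgHom_weylOperator hη hM).eq x

/-- **`M^*` commutes with every `ρ(γ)`, `γ ∈ SL₂(ℂ)`, for `η`-preserving `M`** (`M^*` commutes with `h` and `L_η`, and
`End_{SL₂}(H•) = End_{𝔰𝔩₂}(H•)`). [cite: GoodmanWallachGTM255, §5.5.1 (5.51) (p. 383)] [cite: Lange2023AbelianVarietiesComplex, §7.3.2 Lemma 7.3.6 (p. 338)]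
[cite: Beauville2010SL2, §3 Proposition] -/
theorem commute_pullAlgHom_sl2Rep (hη : ∀ v : E, v ≠ 0 → ∃ w : E, η ![v, w] ≠ 0) {M : E →L[ℝ] E}
    (hM : ∀ u v : E, η ![M u, M v] = η ![u, v]) (γ : SL(2, ℂ)) :
    Commute (GForm.pullAlgHom M).toLinearMap ((hasLefschetzProperty_lefschetzG hη).sl2Rep isZGrading_countingG γ) := by
  have hh : Commute (GForm.pullAlgHom M).toLinearMap (countingG E) := commute_pullAlgHom_countingG M
  have hL : Commute (GForm.pullAlgHom M).toLinearMap (lefschetzG η) := commute_pullAlgHom_lefschetzG hM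
  exact ((hasLefschetzProperty_lefschetzG hη).commute_sl2Rep_iff isZGrading_countingG (GForm.pullAlgHom M).toLinearMap).2 ⟨hh, hL⟩ γ

/-- **`M^*(ρ(γ) x) = ρ(γ)(M^* x)`** for `η`-preserving `M` and `γ ∈ SL₂(ℂ)`. [cite: Beauville2010SL2, §3 Proposition]
[cite: Lange2023AbelianVarietiesComplex, §7.3.2 Lemma 7.3.6 (p. 338)] -/
theorem pullG_sl2Rep_of_preserves (hη : ∀ v : E, v ≠ 0 → ∃ w : E, η ![v, w] ≠ 0) {M : E →L[ℝ] E}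
    (hM : ∀ u v : E, η ![M u, M v] = η ![u, v]) (γ : SL(2, ℂ)) (x : GForm E ℂ) :
    GForm.pullG M ((hasLefschetzProperty_lefschetzG hη).sl2Rep isZGrading_countingG γ x) =
      (hasLefschetzProperty_lefschetzG hη).sl2Rep isZGrading_countingG γ (GForm.pullG M x) :=
  LinearMap.congr_fun (commute_pullAlgHom_sl2Rep hη hM γ).eq x

/-- **Component form: `(w (of k (x ∘ M)))_m = (w (of k x))_m ∘ M`** for `η`-preserving `M`. [cite: Lange2023AbelianVarietiesComplex, §7.3.2 Lemma 7.3.6 (p. 338)] -/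
theorem weylOperator_of_compContinuousLinearMap (hη : ∀ v : E, v ≠ 0 → ∃ w : E, η ![v, w] ≠ 0) {M : E →L[ℝ] E}
    (hM : ∀ u v : E, η ![M u, M v] = η ![u, v]) {k : ℕ} (x : E [⋀^Fin k]→L[ℝ] ℂ) (m : ℕ) :
    (hasLefschetzProperty_lefschetzG hη).weylOperator isZGrading_countingG (GForm.of k (x.compContinuousLinearMap M)) m =
      ((hasLefschetzProperty_lefschetzG hη).weylOperator isZGrading_countingG (GForm.of k x) m).compContinuousLinearMap M := by
  rw [← GForm.pullG_of, ← pullG_weylOperator_of_preserves hη hM, GForm.pullG_apply]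

/-- **Component form: `(ρ(γ) (of k (x ∘ M)))_m = (ρ(γ) (of k x))_m ∘ M`** for `η`-preserving `M`. [cite: Beauville2010SL2, §3 Proposition] -/
theorem sl2Rep_of_compContinuousLinearMap (hη : ∀ v : E, v ≠ 0 → ∃ w : E, η ![v, w] ≠ 0) {M : E →L[ℝ] E}
    (hM : ∀ u v : E, η ![M u, M v] = η ![u, v]) (γ : SL(2, ℂ)) {k : ℕ} (x : E [⋀^Fin k]→L[ℝ] ℂ) (m : ℕ) :
    (hasLefschetzProperty_lefschetzG hη).sl2Rep isZGrading_countingG γ (GForm.of k (x.compContinuousLinearMap M)) m =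
      ((hasLefschetzProperty_lefschetzG hη).sl2Rep isZGrading_countingG γ (GForm.of k x) m).compContinuousLinearMap M := by
  rw [← GForm.pullG_of, ← pullG_sl2Rep_of_preserves hη hM, GForm.pullG_apply]

end Sp

/-! ## §3 Lattice form: `Sp(V, E)(ℝ)` and the Hodge group `Hg(X)(ℝ)` -/

section Lattice

variable {ι : Type*} [Fintype ι] [DecidableEq ι] {E : Type uE} [NormedAddCommGroup E] [NormedSpace ℂ E] [FiniteDimensional ℂ E]
  [Nontrivial E] (Φ : (ι → ℝ) ≃L[ℝ] E) {η : E [⋀^Fin 2]→L[ℝ] ℝ}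

/-- **`ρ_r(N)^*(w x) = w(ρ_r(N)^* x)` for `N ∈ Sp(V, E)(ℝ)`.** [cite: Lange2023AbelianVarietiesComplex, §7.2.1 (p. 330, Sp(V, E)) and §7.3.2 Lemma 7.3.6 (p. 338)] -/
theorem pullG_weylOperator_analyticRepReal_of_mem_spGroup (hη : ∀ v : E, v ≠ 0 → ∃ w : E, η ![v, w] ≠ 0)
    {N : Matrix.SpecialLinearGroup ι ℝ} (hN : N ∈ spGroup Φ η) (x : GForm E ℂ) :
    GForm.pullG (analyticRepReal Φ Φ N.1) ((hasLefschetzProperty_lefschetzG hη).weylOperator isZGrading_countingG x) =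
      (hasLefschetzProperty_lefschetzG hη).weylOperator isZGrading_countingG (GForm.pullG (analyticRepReal Φ Φ N.1) x) :=
  pullG_weylOperator_of_preserves hη ((mem_spGroup_iff Φ).1 hN) x

/-- **`ρ_r(N)^*(ρ(γ) x) = ρ(γ)(ρ_r(N)^* x)` for `N ∈ Sp(V, E)(ℝ)`, `γ ∈ SL₂(ℂ)`.** [cite: Lange2023AbelianVarietiesComplex, §7.2.1 (p. 330) and §7.3.2 Lemma 7.3.6 (p. 338)]
[cite: Beauville2010SL2, §3 Proposition] -/
theorem pullG_sl2Rep_analyticRepReal_of_mem_spGroup (hη : ∀ v : E, v ≠ 0 → ∃ w : E, η ![v, w] ≠ 0)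
    {N : Matrix.SpecialLinearGroup ι ℝ} (hN : N ∈ spGroup Φ η) (γ : SL(2, ℂ)) (x : GForm E ℂ) :
    GForm.pullG (analyticRepReal Φ Φ N.1) ((hasLefschetzProperty_lefschetzG hη).sl2Rep isZGrading_countingG γ x) =
      (hasLefschetzProperty_lefschetzG hη).sl2Rep isZGrading_countingG γ (GForm.pullG (analyticRepReal Φ Φ N.1) x) :=
  pullG_sl2Rep_of_preserves hη ((mem_spGroup_iff Φ).1 hN) γ x

/-- **The Weyl operator commutes with the Hodge group**: `ρ_r(M)^*(w x) = w(ρ_r(M)^* x)` for `M ∈ Hg(X)(ℝ)` and a rational Hodge class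
`η` (`Hg(X) ⊆ Sp(V, E)`, Prop. 7.2.3). [cite: Lange2023AbelianVarietiesComplex, §7.2.1 Prop. 7.2.3 and §7.3.2 Lemma 7.3.6 (p. 338)] -/
theorem pullG_weylOperator_analyticRepReal_hodgeGroup (hη1 : ofRealForm η ∈ hodgeClasses Φ 1)
    (hη : ∀ v : E, v ≠ 0 → ∃ w : E, η ![v, w] ≠ 0) (M : hodgeGroup Φ) (x : GForm E ℂ) :
    GForm.pullG (analyticRepReal Φ Φ (M : Matrix.SpecialLinearGroup ι ℝ).1)
        ((hasLefschetzProperty_lefschetzG hη).weylOperator isZGrading_countingG x) =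
      (hasLefschetzProperty_lefschetzG hη).weylOperator isZGrading_countingG
        (GForm.pullG (analyticRepReal Φ Φ (M : Matrix.SpecialLinearGroup ι ℝ).1) x) :=
  pullG_weylOperator_analyticRepReal_of_mem_spGroup Φ hη (hodgeGroup_le_spGroup Φ hη1 M.2) x

/-- **Beauville's `SL₂`-action commutes with the Hodge group**: `ρ_r(M)^*(ρ(γ) x) = ρ(γ)(ρ_r(M)^* x)` for `M ∈ Hg(X)(ℝ)`, `γ ∈ SL₂(ℂ)`
and a rational Hodge class `η`. [cite: Lange2023AbelianVarietiesComplex, §7.2.1 Prop. 7.2.3 and §7.3.2 Lemma 7.3.6 (p. 338)] [cite: Beauville2010SL2, §3 Proposition] -/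
theorem pullG_sl2Rep_analyticRepReal_hodgeGroup (hη1 : ofRealForm η ∈ hodgeClasses Φ 1)
    (hη : ∀ v : E, v ≠ 0 → ∃ w : E, η ![v, w] ≠ 0) (M : hodgeGroup Φ) (γ : SL(2, ℂ)) (x : GForm E ℂ) :
    GForm.pullG (analyticRepReal Φ Φ (M : Matrix.SpecialLinearGroup ι ℝ).1)
        ((hasLefschetzProperty_lefschetzG hη).sl2Rep isZGrading_countingG γ x) =
      (hasLefschetzProperty_lefschetzG hη).sl2Rep isZGrading_countingG γ
        (GForm.pullG (analyticRepReal Φ Φ (M : Matrix.SpecialLinearGroup ι ℝ).1) x) :=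
  pullG_sl2Rep_analyticRepReal_of_mem_spGroup Φ hη (hodgeGroup_le_spGroup Φ hη1 M.2) γ x

end Lattice

/-! ## §4 Isogenies compatible with the polarisations (Beauville's proof of the `SL₂`-action) -/

section Isogeny

variable {ι ι' : Type*} [Fintype ι] [Fintype ι'] {E : Type uE} [NormedAddCommGroup E] [NormedSpace ℂ E] [FiniteDimensional ℂ E]
  [Nontrivial E] {E' : Type uE'} [NormedAddCommGroup E'] [NormedSpace ℂ E'] [FiniteDimensional ℂ E'] [Nontrivial E']
  (Φ : (ι → ℝ) ≃L[ℝ] E) (Φ' : (ι' → ℝ) ≃L[ℝ] E') {η' : E' [⋀^Fin 2]→L[ℝ] ℝ}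

omit [FiniteDimensional ℂ E] [Nontrivial E] [FiniteDimensional ℂ E'] [Nontrivial E'] in
/-- `f^* L_{η'} = L_{f^*η'} f^*` for the pull-back equivalence of an isogeny, with `f^*η'` written through `realRep`. [cite: LooijengaLunts1997, §1 (1.1), (1.9)] -/
private theorem IsIsogeny.semiconj_lefschetzG_realRep₆₆ {A : Matrix ι' ι ℤ} (h : IsIsogeny Φ Φ' A) (η' : E' [⋀^Fin 2]→L[ℝ] ℝ) (x : GForm E' ℂ) :
    pullEquivG (h.realRepEquiv Φ Φ') (lefschetzG η' x) =
      lefschetzG (η'.compContinuousLinearMap (realRep Φ Φ' A)) (pullEquivG (h.realRepEquiv Φ Φ') x) := by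
  have h1 := semiconj_lefschetzG₆₆ (h.realRepEquiv Φ Φ') η' x
  rwa [h.coe_realRepEquiv] at h1

/-- **`f^*(w_{η'} x) = w_{f^*η'}(f^* x)` for an isogeny `f : X → X'`** (analytic representation `ρ_r(f) = realRep Φ Φ' A`, a real-linear
isomorphism `V ≃ V'`) and a non-degenerate `η'` on `X'`: with `θ = π^*θ_0`, "`d⁻¹(π, π)^*` … induces an isomorphism of algebras
`Corr(A_0) ≅ Corr(A)`". [cite: Beauville2010SL2, §3 Proposition (proof)] [cite: Lange2023AbelianVarietiesComplex, §1.1.2 Lemma 1.1.11] -/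
theorem IsIsogeny.pullG_realRep_weylOperator {A : Matrix ι' ι ℤ} (h : IsIsogeny Φ Φ' A) (hη' : ∀ v : E', v ≠ 0 → ∃ w : E', η' ![v, w] ≠ 0)
    (hη : ∀ v : E, v ≠ 0 → ∃ w : E, (η'.compContinuousLinearMap (realRep Φ Φ' A)) ![v, w] ≠ 0) (x : GForm E' ℂ) :
    GForm.pullG (realRep Φ Φ' A) ((hasLefschetzProperty_lefschetzG hη').weylOperator isZGrading_countingG x) =
      (hasLefschetzProperty_lefschetzG hη).weylOperator isZGrading_countingG (GForm.pullG (realRep Φ Φ' A) x) := by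
  have key := (hasLefschetzProperty_lefschetzG hη').map_weylOperator_of_semiconj isZGrading_countingG (hasLefschetzProperty_lefschetzG hη)
    isZGrading_countingG (Φ := (pullEquivG (h.realRepEquiv Φ Φ')).toLinearMap) (semiconj_countingG₆₆ _) (h.semiconj_lefschetzG_realRep₆₆ Φ Φ' η') x
  rw [LinearEquiv.coe_coe, pullEquivG_apply, pullEquivG_apply, h.coe_realRepEquiv] at key
  exact key

/-- **`Ad(f^*) w_{η'} = w_{f^*η'}`** for an isogeny `f`. [cite: Beauville2010SL2, §3 Proposition (proof)] [cite: LooijengaLunts1997, §1 (1.9)] -/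
theorem IsIsogeny.adPull_realRepEquiv_weylOperator {A : Matrix ι' ι ℤ} (h : IsIsogeny Φ Φ' A)
    (hη' : ∀ v : E', v ≠ 0 → ∃ w : E', η' ![v, w] ≠ 0)
    (hη : ∀ v : E, v ≠ 0 → ∃ w : E, (η'.compContinuousLinearMap (realRep Φ Φ' A)) ![v, w] ≠ 0) :
    adPull (h.realRepEquiv Φ Φ') ((hasLefschetzProperty_lefschetzG hη').weylOperator isZGrading_countingG) =
      (hasLefschetzProperty_lefschetzG hη).weylOperator isZGrading_countingG := by
  rw [adPull_eq_conj₆₆]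
  exact (hasLefschetzProperty_lefschetzG hη').conj_weylOperator_eq isZGrading_countingG (hasLefschetzProperty_lefschetzG hη)
    isZGrading_countingG (pullEquivG (h.realRepEquiv Φ Φ')) (semiconj_countingG₆₆ _) (h.semiconj_lefschetzG_realRep₆₆ Φ Φ' η')

/-- **`f^*(ρ_{η'}(γ) x) = ρ_{f^*η'}(γ)(f^* x)` for an isogeny `f : X → X'` and every `γ ∈ SL₂(ℂ)`** — Beauville's transport of the
`SL₂`-action along `π : A → A_0` with `θ = π^*θ_0`. [cite: Beauville2010SL2, §3 Proposition (proof)] [cite: Lange2023AbelianVarietiesComplex, §1.1.2 Lemma 1.1.11] -/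
theorem IsIsogeny.pullG_realRep_sl2Rep {A : Matrix ι' ι ℤ} (h : IsIsogeny Φ Φ' A) (hη' : ∀ v : E', v ≠ 0 → ∃ w : E', η' ![v, w] ≠ 0)
    (hη : ∀ v : E, v ≠ 0 → ∃ w : E, (η'.compContinuousLinearMap (realRep Φ Φ' A)) ![v, w] ≠ 0) (γ : SL(2, ℂ)) (x : GForm E' ℂ) :
    GForm.pullG (realRep Φ Φ' A) ((hasLefschetzProperty_lefschetzG hη').sl2Rep isZGrading_countingG γ x) =
      (hasLefschetzProperty_lefschetzG hη).sl2Rep isZGrading_countingG γ (GForm.pullG (realRep Φ Φ' A) x) := by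
  have key := (hasLefschetzProperty_lefschetzG hη').map_sl2Rep_of_semiconj isZGrading_countingG (hasLefschetzProperty_lefschetzG hη)
    isZGrading_countingG (Φ := (pullEquivG (h.realRepEquiv Φ Φ')).toLinearMap) (semiconj_countingG₆₆ _) (h.semiconj_lefschetzG_realRep₆₆ Φ Φ' η') γ x
  rw [LinearEquiv.coe_coe, pullEquivG_apply, pullEquivG_apply, h.coe_realRepEquiv] at key
  exact key

/-- **`Ad(f^*) ρ_{η'}(γ) = ρ_{f^*η'}(γ)`** for an isogeny `f` and `γ ∈ SL₂(ℂ)`. [cite: Beauville2010SL2, §3 Proposition (proof)] [cite: LooijengaLunts1997, §1 (1.9)] -/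
theorem IsIsogeny.adPull_realRepEquiv_sl2Rep {A : Matrix ι' ι ℤ} (h : IsIsogeny Φ Φ' A)
    (hη' : ∀ v : E', v ≠ 0 → ∃ w : E', η' ![v, w] ≠ 0)
    (hη : ∀ v : E, v ≠ 0 → ∃ w : E, (η'.compContinuousLinearMap (realRep Φ Φ' A)) ![v, w] ≠ 0) (γ : SL(2, ℂ)) :
    adPull (h.realRepEquiv Φ Φ') ((hasLefschetzProperty_lefschetzG hη').sl2Rep isZGrading_countingG γ) =
      (hasLefschetzProperty_lefschetzG hη).sl2Rep isZGrading_countingG γ := by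
  rw [adPull_eq_conj₆₆]
  exact (hasLefschetzProperty_lefschetzG hη').conj_sl2Rep_eq isZGrading_countingG (hasLefschetzProperty_lefschetzG hη)
    isZGrading_countingG (pullEquivG (h.realRepEquiv Φ Φ')) (semiconj_countingG₆₆ _) (h.semiconj_lefschetzG_realRep₆₆ Φ Φ' η') γ

omit [Nontrivial E'] in
/-- **Non-degeneracy pulls back along an isogeny**: `f^*η'` is non-degenerate iff `η'` is. [cite: Lange2023AbelianVarietiesComplex, §1.1.2 Lemma 1.1.11]
[cite: LooijengaLunts1997, §1 (1.1)] -/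
theorem IsIsogeny.nondegenerate_comp_realRep_iff {A : Matrix ι' ι ℤ} (h : IsIsogeny Φ Φ' A) :
    (∀ v : E, v ≠ 0 → ∃ w : E, (η'.compContinuousLinearMap (realRep Φ Φ' A)) ![v, w] ≠ 0) ↔
      ∀ v : E', v ≠ 0 → ∃ w : E', η' ![v, w] ≠ 0 := by
  rw [← h.coe_realRepEquiv]
  exact nondegenerate_pullTwo_iff _

end Isogeny

end ComplexTorus

end Literature.Geometry.Kaehler

end
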